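import Literature.Topology.FourManifolds.TorusCurveTubes
import HarnessLib

/-!
# The quarter-arc product charts of the torus `S¹ × S¹` recharted on `ℝ²`

Topic `Literature/Topology/FourManifolds` (fact seat of the Seiberg–Witten leaf
`Literature.Barriers.SmoothPoincare4.akhmedovPark2010_lemma8_invariants`; block 2 of
Akhmedov–Park's `X₁(m)`, A. Akhmedov, B. D. Park, Invent. Math. 181 (2010), §3: the genus-two
surface `Σ̄₂ ⊂ T⁴ # ℂℙ²bar` obtained from two tori by resolving one double point and blowing up
the other).  Both operations are local models in `ℂ × ℂ`
(`DoublePointResolutionNeck.lean`, `BlowUpLineCapTube.lean`) to be implanted through CHARTS of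
the torus `T = Rechart f₂ (S¹ × S¹)` (and of `T⁴`) centred at the double points, with TARGET ALL
OF `ℝ²` (the shape of chart Kervaire–Milnor's connected sum asks for,
`Literature.Topology.FourManifolds.ConnectedSumData`) and in which the tree's quarter-arc tubes
(`CircleQuarterArcs.lean`, `TorusCurveTubes.lean`, `SurfaceTimesTorusTube.lean`) are LINEAR.
This file provides these charts (everything proved; no definitions, no named facts):

* `exists_torusQuarterChart` — for a recharting `f₂` (smooth both ways), a centre
  `θ = (θ₁, θ₂) ∈ S¹ × S¹` and a scale `c > 0` there is a chart `e` of the maximal `C^∞` atlas of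
  `T = Rechart f₂ (S¹ × S¹)` with `e.target = univ`,
  `e.source = {x | (out x).1 ∈ arc about θ₁ ∧ (out x).2 ∈ arc about θ₂}` (the product of the two
  open quarter arcs `{Re (z θ⁻¹) > 0 ∧ Re ((z θ⁻¹)²) > 0}`), given by the tangent-of-the-doubled-
  angle coordinates `e x = c • (ℓ_{θ₁} (out x).1, ℓ_{θ₂} (out x).2)`,
  `ℓ_θ z = Im ((z θ⁻¹)²)/Re ((z θ⁻¹)²)`, with inverse
  `e.symm v = into (θ₁ · exp(i arctan(v₀/c)/2), θ₂ · exp(i arctan(v₁/c)/2))` and `e (into θ) = 0`;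
  in particular along the arcs `t ↦ θᵢ · exp(i arctan(t)/2)` the coordinates are `c t`: the tubes
  of the tree are linear in these charts;
* `exists_torusMixedChart` — the same with the HALF-circle coordinate `Im (z θ₂⁻¹)/Re (z θ₂⁻¹)` in
  the second factor (inverse `θ₂ · exp(i arctan(v₁/c))`), the chart adapted to the plumbing
  coordinates of `F × T²` (`SurfaceTimesTorusPlumbingChart.lean`).

## References

* A. Akhmedov, B. D. Park, Invent. Math. 181 (2010) 577–603, §3. [AkhmedovPark2010]
* J. M. Lee, *Introduction to Smooth Manifolds*, 2nd ed. (2013), Prop. 1.17 (smoothly compatible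
  charts belong to the maximal atlas). [LeeSmoothManifolds2013]
-/

noncomputable section

open scoped Manifold ContDiff Topology
open Set Function
open Literature.Geometry.Manifold (Rechart)

namespace Literature.Topology.FourManifolds

namespace TorusQuarterChart

/-- The doubled-angle tangent coordinate `ℓ z = Im z²/Re z²` inverts the quarter arc:
`ℓ (exp(i arctan(t)/2)) = t`. [folklore] -/
theorem coord_arc (θ : Circle) (t : ℝ) :
    ((((θ * Circle.exp (Real.arctan t / 2)) * θ⁻¹ : Circle) : ℂ) ^ 2).im /
      ((((θ * Circle.exp (Real.arctan t / 2)) * θ⁻¹ : Circle) : ℂ) ^ 2).re = t := by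
  rw [mul_inv_cancel_comm]
  exact im_sq_div_re_sq_circleExp_arctan_half t

/-- The quarter arc inverts the coordinate on the arc: `θ · exp(i arctan(ℓ_θ z)/2) = z` for `z` in
the arc about `θ`. [folklore] -/
theorem arc_coord {θ z : Circle} (hz : 0 < (((z * θ⁻¹ : Circle) : ℂ)).re)
    (hz2 : 0 < ((((z * θ⁻¹ : Circle) : ℂ)) ^ 2).re) :
    θ * Circle.exp (Real.arctan ((((z * θ⁻¹ : Circle) : ℂ) ^ 2).im /
      (((z * θ⁻¹ : Circle) : ℂ) ^ 2).re) / 2) = z := by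
  rw [circleExp_arctan_half_eq hz hz2, mul_comm, inv_mul_cancel_right]

/-- Points of the arc about `θ`. [folklore] -/
theorem arc_mem (θ : Circle) (t : ℝ) :
    0 < ((((θ * Circle.exp (Real.arctan t / 2)) * θ⁻¹ : Circle) : ℂ)).re ∧
      0 < ((((θ * Circle.exp (Real.arctan t / 2)) * θ⁻¹ : Circle) : ℂ) ^ 2).re := by
  rw [mul_inv_cancel_comm]
  exact ⟨re_circleExp_arctan_half_pos t, re_sq_circleExp_arctan_half_pos t⟩

/-- The coordinate `ℓ_θ` is smooth on the arc about `θ` (indeed wherever `Re ((z θ⁻¹)²) ≠ 0`).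
[folklore] -/
theorem contMDiffOn_coord (θ : Circle) :
    ContMDiffOn (𝓡 1) 𝓘(ℝ, ℝ) ∞
      (fun z : Circle => (((z * θ⁻¹ : Circle) : ℂ) ^ 2).im / (((z * θ⁻¹ : Circle) : ℂ) ^ 2).re)
      {z : Circle | 0 < ((((z * θ⁻¹ : Circle) : ℂ)) ^ 2).re} := by
  haveI : Fact (Module.finrank ℝ ℂ = 1 + 1) := finrank_real_complex_fact'
  have hcoe : ContMDiff (𝓡 1) 𝓘(ℝ, ℂ) ∞ (fun z : Circle => (z : ℂ)) := contMDiff_coe_sphere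
  have hrot : ContMDiff (𝓡 1) (𝓡 1) ∞ (fun z : Circle => z * θ⁻¹) := contMDiff_mul_right
  exact contDiffOn_im_sq_div_re_sq.contMDiffOn.comp (hcoe.comp hrot).contMDiffOn
    fun z hz => ne_of_gt hz

end TorusQuarterChart

open TorusQuarterChart in
/-- **The quarter-arc product chart of the recharted torus at a centre `θ`, with target all of
`ℝ²`.**  For a recharting `f` of `S¹ × S¹` on `ℝ²` smooth both ways, a centre
`θ = (θ₁, θ₂) ∈ S¹ × S¹` and a scale `c > 0` there is a chart `e` of the maximal `C^∞` atlas of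
`Rechart f (S¹ × S¹)` whose source is the product of the open quarter arcs about `θ₁`, `θ₂`,
whose target is all of `ℝ²`, which reads `e x = c • (ℓ_{θ₁} (out x).1, ℓ_{θ₂} (out x).2)`
(`ℓ_θ z = Im ((z θ⁻¹)²)/Re ((z θ⁻¹)²)`, the tangent of the doubled angle), whose inverse is
`v ↦ into (θ₁ exp(i arctan(v₀/c)/2), θ₂ exp(i arctan(v₁/c)/2))`, and which is centred:
`e (into θ) = 0`.  (Smoothly compatible with the product atlas, hence in the maximal atlas,
Lee Prop. 1.17; `OpenPartialHomeomorph.mem_maximalAtlas_of_contMDiffOn`.)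
[cite: LeeSmoothManifolds2013, Prop. 1.17] -/
theorem exists_torusQuarterChart
    {f : ModelProd (EuclideanSpace ℝ (Fin 1)) (EuclideanSpace ℝ (Fin 1)) ≃ₜ EuclideanSpace ℝ (Fin 2)}
    (hf : ContMDiff ((𝓡 1).prod (𝓡 1)) 𝓘(ℝ, EuclideanSpace ℝ (Fin 2)) ∞ f)
    (hf' : ContMDiff 𝓘(ℝ, EuclideanSpace ℝ (Fin 2)) ((𝓡 1).prod (𝓡 1)) ∞ f.symm)
    (θ₁ θ₂ : Circle) {c : ℝ} (hc : 0 < c) :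
    ∃ e : OpenPartialHomeomorph (Rechart f (Circle × Circle)) (EuclideanSpace ℝ (Fin 2)),
      e ∈ IsManifold.maximalAtlas (𝓡 2) ∞ (Rechart f (Circle × Circle)) ∧
      e.target = univ ∧
      e.source = {x | (0 < ((((Rechart.out f (Circle × Circle) x).1 * θ₁⁻¹ : Circle) : ℂ)).re ∧
          0 < ((((Rechart.out f (Circle × Circle) x).1 * θ₁⁻¹ : Circle) : ℂ) ^ 2).re) ∧
        (0 < ((((Rechart.out f (Circle × Circle) x).2 * θ₂⁻¹ : Circle) : ℂ)).re ∧
          0 < ((((Rechart.out f (Circle × Circle) x).2 * θ₂⁻¹ : Circle) : ℂ) ^ 2).re)} ∧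
      (∀ x, e x 0 = c * ((((((Rechart.out f (Circle × Circle) x).1 * θ₁⁻¹ : Circle) : ℂ) ^ 2).im /
          ((((Rechart.out f (Circle × Circle) x).1 * θ₁⁻¹ : Circle) : ℂ) ^ 2).re)) ∧
        e x 1 = c * ((((((Rechart.out f (Circle × Circle) x).2 * θ₂⁻¹ : Circle) : ℂ) ^ 2).im /
          ((((Rechart.out f (Circle × Circle) x).2 * θ₂⁻¹ : Circle) : ℂ) ^ 2).re))) ∧
      (∀ v : EuclideanSpace ℝ (Fin 2), e.symm v = Rechart.into f (Circle × Circle)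
        (θ₁ * Circle.exp (Real.arctan (v 0 / c) / 2), θ₂ * Circle.exp (Real.arctan (v 1 / c) / 2))) ∧
      e (Rechart.into f (Circle × Circle) (θ₁, θ₂)) = 0 := by
  haveI hT : IsManifold (𝓡 2) ∞ (Rechart f (Circle × Circle)) := Rechart.isManifold f _ hf hf'
  haveI : Fact (Module.finrank ℝ ℂ = 1 + 1) := finrank_real_complex_fact'
  -- notation
  let out := Rechart.out f (Circle × Circle)
  let into := Rechart.into f (Circle × Circle)
  let ℓ : Circle → Circle → ℝ := fun θ z =>
    (((z * θ⁻¹ : Circle) : ℂ) ^ 2).im / (((z * θ⁻¹ : Circle) : ℂ) ^ 2).re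
  let arc : Circle → ℝ → Circle := fun θ t => θ * Circle.exp (Real.arctan t / 2)
  let e₀ : EuclideanSpace ℝ (Fin 2) := EuclideanSpace.single 0 1
  let e₁ : EuclideanSpace ℝ (Fin 2) := EuclideanSpace.single 1 1
  let S : Set (Rechart f (Circle × Circle)) :=
    {x | (0 < ((((out x).1 * θ₁⁻¹ : Circle) : ℂ)).re ∧ 0 < ((((out x).1 * θ₁⁻¹ : Circle) : ℂ) ^ 2).re) ∧
      (0 < ((((out x).2 * θ₂⁻¹ : Circle) : ℂ)).re ∧ 0 < ((((out x).2 * θ₂⁻¹ : Circle) : ℂ) ^ 2).re)}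
  let F : Rechart f (Circle × Circle) → EuclideanSpace ℝ (Fin 2) :=
    fun x => (c * ℓ θ₁ (out x).1) • e₀ + (c * ℓ θ₂ (out x).2) • e₁
  let G : EuclideanSpace ℝ (Fin 2) → Rechart f (Circle × Circle) :=
    fun v => into (arc θ₁ (v 0 / c), arc θ₂ (v 1 / c))
  have hF0 : ∀ x, F x 0 = c * ℓ θ₁ (out x).1 := fun x => by simp [F, e₀, e₁]
  have hF1 : ∀ x, F x 1 = c * ℓ θ₂ (out x).2 := fun x => by simp [F, e₀, e₁]
  have hGF : ∀ x ∈ S, G (F x) = x := by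
    intro x hx
    obtain ⟨⟨h₁, h₁'⟩, ⟨h₂, h₂'⟩⟩ := hx
    show into (arc θ₁ (F x 0 / c), arc θ₂ (F x 1 / c)) = x
    rw [hF0, hF1, mul_div_cancel_left₀ _ hc.ne', mul_div_cancel_left₀ _ hc.ne']
    show into (θ₁ * Circle.exp (Real.arctan (ℓ θ₁ (out x).1) / 2),
      θ₂ * Circle.exp (Real.arctan (ℓ θ₂ (out x).2) / 2)) = x
    rw [arc_coord h₁ h₁', arc_coord h₂ h₂', Prod.mk.eta]
    exact Rechart.into_out f _ x
  have hFG : ∀ v, F (G v) = v := by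
    intro v
    have hout : out (G v) = (arc θ₁ (v 0 / c), arc θ₂ (v 1 / c)) := Rechart.out_into f _ _
    ext i
    fin_cases i
    · show F (G v) 0 = v 0
      rw [hF0, hout]
      show c * (((((θ₁ * Circle.exp (Real.arctan (v 0 / c) / 2)) * θ₁⁻¹ : Circle) : ℂ) ^ 2).im /
        ((((θ₁ * Circle.exp (Real.arctan (v 0 / c) / 2)) * θ₁⁻¹ : Circle) : ℂ) ^ 2).re) = v 0
      rw [coord_arc, mul_div_cancel₀ _ hc.ne']
    · show F (G v) 1 = v 1
      rw [hF1, hout]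
      show c * (((((θ₂ * Circle.exp (Real.arctan (v 1 / c) / 2)) * θ₂⁻¹ : Circle) : ℂ) ^ 2).im /
        ((((θ₂ * Circle.exp (Real.arctan (v 1 / c) / 2)) * θ₂⁻¹ : Circle) : ℂ) ^ 2).re) = v 1
      rw [coord_arc, mul_div_cancel₀ _ hc.ne']
  have hGS : ∀ v, G v ∈ S := by
    intro v
    show (0 < ((((out (G v)).1 * θ₁⁻¹ : Circle) : ℂ)).re ∧ _) ∧ _
    rw [show out (G v) = (arc θ₁ (v 0 / c), arc θ₂ (v 1 / c)) from Rechart.out_into f _ _]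
    exact ⟨arc_mem θ₁ _, arc_mem θ₂ _⟩
  -- continuity and smoothness
  have hout : ContMDiff (𝓡 2) ((𝓡 1).prod (𝓡 1)) ∞ out := Rechart.contMDiff_out f _ hf hf'
  have hinto : ContMDiff ((𝓡 1).prod (𝓡 1)) (𝓡 2) ∞ into := Rechart.contMDiff_into f _ hf hf'
  have hSo : IsOpen S := by
    have h₁ : IsOpen {z : Circle | 0 < (((z * θ₁⁻¹ : Circle) : ℂ)).re ∧
        0 < ((((z * θ₁⁻¹ : Circle) : ℂ)) ^ 2).re} :=
      isOpen_setOf_re_pos_re_sq_pos.preimage (continuous_mul_const θ₁⁻¹)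
    have h₂ : IsOpen {z : Circle | 0 < (((z * θ₂⁻¹ : Circle) : ℂ)).re ∧
        0 < ((((z * θ₂⁻¹ : Circle) : ℂ)) ^ 2).re} :=
      isOpen_setOf_re_pos_re_sq_pos.preimage (continuous_mul_const θ₂⁻¹)
    exact ((h₁.preimage continuous_fst).inter (h₂.preimage continuous_snd)).preimage hout.continuous
  have hFsm : ContMDiffOn (𝓡 2) 𝓘(ℝ, EuclideanSpace ℝ (Fin 2)) ∞ F S := by
    have hℓ₁ : ContMDiffOn (𝓡 2) 𝓘(ℝ, ℝ) ∞ (fun x => ℓ θ₁ (out x).1) S :=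
      (contMDiffOn_coord θ₁).comp (contMDiff_fst.comp hout).contMDiffOn fun x hx => hx.1.2
    have hℓ₂ : ContMDiffOn (𝓡 2) 𝓘(ℝ, ℝ) ∞ (fun x => ℓ θ₂ (out x).2) S :=
      (contMDiffOn_coord θ₂).comp (contMDiff_snd.comp hout).contMDiffOn fun x hx => hx.2.2
    exact ((contMDiffOn_const.mul hℓ₁).smul contMDiffOn_const).add
      ((contMDiffOn_const.mul hℓ₂).smul contMDiffOn_const)
  have hproj : ∀ i : Fin 2, ContMDiff (𝓡 2) 𝓘(ℝ, ℝ) ∞ (fun v : EuclideanSpace ℝ (Fin 2) => v i) :=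
    fun i => (EuclideanSpace.proj (𝕜 := ℝ) (ι := Fin 2) i).contMDiff
  have hGsm : ContMDiff 𝓘(ℝ, EuclideanSpace ℝ (Fin 2)) (𝓡 2) ∞ G := by
    obtain ⟨-, harc₁, -⟩ := injective_contMDiff_isOpenMap_mul_circleExp_arctan_half θ₁
    obtain ⟨-, harc₂, -⟩ := injective_contMDiff_isOpenMap_mul_circleExp_arctan_half θ₂
    have h0 : ContMDiff 𝓘(ℝ, EuclideanSpace ℝ (Fin 2)) 𝓘(ℝ, ℝ) ∞
        (fun v : EuclideanSpace ℝ (Fin 2) => v 0 / c) := (hproj 0).div_const c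
    have h1 : ContMDiff 𝓘(ℝ, EuclideanSpace ℝ (Fin 2)) 𝓘(ℝ, ℝ) ∞
        (fun v : EuclideanSpace ℝ (Fin 2) => v 1 / c) := (hproj 1).div_const c
    exact hinto.comp ((harc₁.comp h0).prodMk (harc₂.comp h1))
  -- the chart
  let e : OpenPartialHomeomorph (Rechart f (Circle × Circle)) (EuclideanSpace ℝ (Fin 2)) :=
    { toFun := F
      invFun := G
      source := S
      target := univ
      map_source' := fun _ _ => mem_univ _
      map_target' := fun v _ => hGS v
      left_inv' := fun x hx => hGF x hx
      right_inv' := fun v _ => hFG v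
      open_source := hSo
      open_target := isOpen_univ
      continuousOn_toFun := hFsm.continuousOn
      continuousOn_invFun := hGsm.continuous.continuousOn }
  have he : e ∈ IsManifold.maximalAtlas (𝓡 2) ∞ (Rechart f (Circle × Circle)) :=
    e.mem_maximalAtlas_of_contMDiffOn hFsm hGsm.contMDiffOn
  refine ⟨e, he, rfl, rfl, fun x => ⟨hF0 x, hF1 x⟩, fun v => rfl, ?_⟩
  -- centred
  show F (into (θ₁, θ₂)) = 0
  have h : out (into (θ₁, θ₂)) = (θ₁, θ₂) := Rechart.out_into f _ _
  ext i
  fin_cases i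
  · show F (into (θ₁, θ₂)) 0 = 0
    rw [hF0, h]
    simp [ℓ]
  · show F (into (θ₁, θ₂)) 1 = 0
    rw [hF1, h]
    simp [ℓ]


namespace TorusQuarterChart

/-- The half-circle coordinate `h_θ z = Im (z θ⁻¹)/Re (z θ⁻¹)` is smooth on the half circle about `θ`.
[folklore] -/
theorem contMDiffOn_halfCoord (θ : Circle) :
    ContMDiffOn (𝓡 1) 𝓘(ℝ, ℝ) ∞
      (fun z : Circle => (((z * θ⁻¹ : Circle) : ℂ)).im / (((z * θ⁻¹ : Circle) : ℂ)).re)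
      {z : Circle | 0 < ((((z * θ⁻¹ : Circle) : ℂ))).re} := by
  haveI : Fact (Module.finrank ℝ ℂ = 1 + 1) := finrank_real_complex_fact'
  have hcoe : ContMDiff (𝓡 1) 𝓘(ℝ, ℂ) ∞ (fun z : Circle => (z : ℂ)) := contMDiff_coe_sphere
  have hrot : ContMDiff (𝓡 1) (𝓡 1) ∞ (fun z : Circle => z * θ⁻¹) := contMDiff_mul_right
  have hre : ContMDiff (𝓡 1) 𝓘(ℝ, ℝ) ∞ fun z : Circle => (((z * θ⁻¹ : Circle) : ℂ)).re :=
    Complex.reCLM.contMDiff.comp (hcoe.comp hrot)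
  have him : ContMDiff (𝓡 1) 𝓘(ℝ, ℝ) ∞ fun z : Circle => (((z * θ⁻¹ : Circle) : ℂ)).im :=
    Complex.imCLM.contMDiff.comp (hcoe.comp hrot)
  exact him.contMDiffOn.div₀ hre.contMDiffOn fun z hz => ne_of_gt hz

end TorusQuarterChart

open TorusQuarterChart in
/-- **The mixed chart of the recharted torus at a centre `θ`: quarter-arc coordinate in the first
factor, half-circle coordinate in the second, target all of `ℝ²`.**  For a recharting `f` of `S¹ × S¹` on `ℝ²` smooth both ways, a centre
`θ = (θ₁, θ₂) ∈ S¹ × S¹` and a scale `c > 0` there is a chart `e` of the maximal `C^∞` atlas of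
`Rechart f (S¹ × S¹)` whose source is the product of the open quarter arc about `θ₁` with the open half circle about
`θ₂`, whose target is all of `ℝ²`, which reads `e x = c • (ℓ_{θ₁} (out x).1, h_{θ₂} (out x).2)`
(`ℓ_θ z = Im ((z θ⁻¹)²)/Re ((z θ⁻¹)²)`, the tangent of the doubled angle; `h_θ z = Im (z θ⁻¹)/Re (z θ⁻¹)`,
the tangent of the angle), whose inverse is `v ↦ into (θ₁ exp(i arctan(v₀/c)/2), θ₂ exp(i arctan(v₁/c)))`,
and which is centred.  (The chart in which the second sheet `T_β` of Akhmedov–Park's block 2,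
parametrised by `(σ, τ) ↦ (η(σ), σ², τ)`, reads its plumbing coordinate `b = c (tan 2∠σ, tan ∠τ)`.)  (Smoothly compatible with the product atlas, hence in the maximal atlas,
Lee Prop. 1.17; `OpenPartialHomeomorph.mem_maximalAtlas_of_contMDiffOn`.)
[cite: LeeSmoothManifolds2013, Prop. 1.17] -/
theorem exists_torusMixedChart
    {f : ModelProd (EuclideanSpace ℝ (Fin 1)) (EuclideanSpace ℝ (Fin 1)) ≃ₜ EuclideanSpace ℝ (Fin 2)}
    (hf : ContMDiff ((𝓡 1).prod (𝓡 1)) 𝓘(ℝ, EuclideanSpace ℝ (Fin 2)) ∞ f)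
    (hf' : ContMDiff 𝓘(ℝ, EuclideanSpace ℝ (Fin 2)) ((𝓡 1).prod (𝓡 1)) ∞ f.symm)
    (θ₁ θ₂ : Circle) {c : ℝ} (hc : 0 < c) :
    ∃ e : OpenPartialHomeomorph (Rechart f (Circle × Circle)) (EuclideanSpace ℝ (Fin 2)),
      e ∈ IsManifold.maximalAtlas (𝓡 2) ∞ (Rechart f (Circle × Circle)) ∧
      e.target = univ ∧
      e.source = {x | (0 < ((((Rechart.out f (Circle × Circle) x).1 * θ₁⁻¹ : Circle) : ℂ)).re ∧
          0 < ((((Rechart.out f (Circle × Circle) x).1 * θ₁⁻¹ : Circle) : ℂ) ^ 2).re) ∧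
        0 < ((((Rechart.out f (Circle × Circle) x).2 * θ₂⁻¹ : Circle) : ℂ)).re} ∧
      (∀ x, e x 0 = c * ((((((Rechart.out f (Circle × Circle) x).1 * θ₁⁻¹ : Circle) : ℂ) ^ 2).im /
          ((((Rechart.out f (Circle × Circle) x).1 * θ₁⁻¹ : Circle) : ℂ) ^ 2).re)) ∧
        e x 1 = c * ((((Rechart.out f (Circle × Circle) x).2 * θ₂⁻¹ : Circle) : ℂ).im /
          (((Rechart.out f (Circle × Circle) x).2 * θ₂⁻¹ : Circle) : ℂ).re)) ∧
      (∀ v : EuclideanSpace ℝ (Fin 2), e.symm v = Rechart.into f (Circle × Circle)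
        (θ₁ * Circle.exp (Real.arctan (v 0 / c) / 2), θ₂ * Circle.exp (Real.arctan (v 1 / c)))) ∧
      e (Rechart.into f (Circle × Circle) (θ₁, θ₂)) = 0 := by
  haveI hT : IsManifold (𝓡 2) ∞ (Rechart f (Circle × Circle)) := Rechart.isManifold f _ hf hf'
  haveI : Fact (Module.finrank ℝ ℂ = 1 + 1) := finrank_real_complex_fact'
  -- notation
  let out := Rechart.out f (Circle × Circle)
  let into := Rechart.into f (Circle × Circle)
  let ℓ : Circle → Circle → ℝ := fun θ z =>
    (((z * θ⁻¹ : Circle) : ℂ) ^ 2).im / (((z * θ⁻¹ : Circle) : ℂ) ^ 2).re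
  let ℓh : Circle → Circle → ℝ := fun θ z => (((z * θ⁻¹ : Circle) : ℂ)).im / (((z * θ⁻¹ : Circle) : ℂ)).re
  let arc : Circle → ℝ → Circle := fun θ t => θ * Circle.exp (Real.arctan t / 2)
  let arch : Circle → ℝ → Circle := fun θ t => θ * Circle.exp (Real.arctan t)
  have hℓh_arch : ∀ θ t, ℓh θ (arch θ t) = t := fun θ t => by
    show (((θ * Circle.exp (Real.arctan t) * θ⁻¹ : Circle) : ℂ)).im /
      (((θ * Circle.exp (Real.arctan t) * θ⁻¹ : Circle) : ℂ)).re = t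
    rw [mul_inv_cancel_comm]; exact im_div_re_circleExp_arctan t
  have harch_ℓh : ∀ {θ z : Circle}, 0 < (((z * θ⁻¹ : Circle) : ℂ)).re → arch θ (ℓh θ z) = z :=
    fun {θ z} hz => by
      show θ * Circle.exp (Real.arctan ((((z * θ⁻¹ : Circle) : ℂ)).im / (((z * θ⁻¹ : Circle) : ℂ)).re)) = z
      rw [circleExp_arctan_im_div_re hz, mul_comm, inv_mul_cancel_right]
  have harch_mem : ∀ θ t, 0 < ((((arch θ t) * θ⁻¹ : Circle) : ℂ)).re := fun θ t => by
    show 0 < (((θ * Circle.exp (Real.arctan t) * θ⁻¹ : Circle) : ℂ)).re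
    rw [mul_inv_cancel_comm]; exact re_circleExp_arctan_pos t
  let e₀ : EuclideanSpace ℝ (Fin 2) := EuclideanSpace.single 0 1
  let e₁ : EuclideanSpace ℝ (Fin 2) := EuclideanSpace.single 1 1
  let S : Set (Rechart f (Circle × Circle)) :=
    {x | (0 < ((((out x).1 * θ₁⁻¹ : Circle) : ℂ)).re ∧ 0 < ((((out x).1 * θ₁⁻¹ : Circle) : ℂ) ^ 2).re) ∧
      0 < ((((out x).2 * θ₂⁻¹ : Circle) : ℂ)).re}
  let F : Rechart f (Circle × Circle) → EuclideanSpace ℝ (Fin 2) :=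
    fun x => (c * ℓ θ₁ (out x).1) • e₀ + (c * ℓh θ₂ (out x).2) • e₁
  let G : EuclideanSpace ℝ (Fin 2) → Rechart f (Circle × Circle) :=
    fun v => into (arc θ₁ (v 0 / c), arch θ₂ (v 1 / c))
  have hF0 : ∀ x, F x 0 = c * ℓ θ₁ (out x).1 := fun x => by simp [F, e₀, e₁]
  have hF1 : ∀ x, F x 1 = c * ℓh θ₂ (out x).2 := fun x => by simp [F, e₀, e₁]
  have hGF : ∀ x ∈ S, G (F x) = x := by
    intro x hx
    obtain ⟨⟨h₁, h₁'⟩, h₂⟩ := hx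
    show into (arc θ₁ (F x 0 / c), arch θ₂ (F x 1 / c)) = x
    rw [hF0, hF1, mul_div_cancel_left₀ _ hc.ne', mul_div_cancel_left₀ _ hc.ne']
    show into (θ₁ * Circle.exp (Real.arctan (ℓ θ₁ (out x).1) / 2), arch θ₂ (ℓh θ₂ (out x).2)) = x
    rw [arc_coord h₁ h₁', harch_ℓh h₂, Prod.mk.eta]
    exact Rechart.into_out f _ x
  have hFG : ∀ v, F (G v) = v := by
    intro v
    have hout : out (G v) = (arc θ₁ (v 0 / c), arch θ₂ (v 1 / c)) := Rechart.out_into f _ _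
    ext i
    fin_cases i
    · show F (G v) 0 = v 0
      rw [hF0, hout]
      show c * (((((θ₁ * Circle.exp (Real.arctan (v 0 / c) / 2)) * θ₁⁻¹ : Circle) : ℂ) ^ 2).im /
        ((((θ₁ * Circle.exp (Real.arctan (v 0 / c) / 2)) * θ₁⁻¹ : Circle) : ℂ) ^ 2).re) = v 0
      rw [coord_arc, mul_div_cancel₀ _ hc.ne']
    · show F (G v) 1 = v 1
      rw [hF1, hout]
      show c * ℓh θ₂ (arch θ₂ (v 1 / c)) = v 1
      rw [hℓh_arch, mul_div_cancel₀ _ hc.ne']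
  have hGS : ∀ v, G v ∈ S := by
    intro v
    show (0 < ((((out (G v)).1 * θ₁⁻¹ : Circle) : ℂ)).re ∧ _) ∧ _
    rw [show out (G v) = (arc θ₁ (v 0 / c), arch θ₂ (v 1 / c)) from Rechart.out_into f _ _]
    exact ⟨arc_mem θ₁ _, harch_mem θ₂ _⟩
  -- continuity and smoothness
  have hout : ContMDiff (𝓡 2) ((𝓡 1).prod (𝓡 1)) ∞ out := Rechart.contMDiff_out f _ hf hf'
  have hinto : ContMDiff ((𝓡 1).prod (𝓡 1)) (𝓡 2) ∞ into := Rechart.contMDiff_into f _ hf hf'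
  have hSo : IsOpen S := by
    have h₁ : IsOpen {z : Circle | 0 < (((z * θ₁⁻¹ : Circle) : ℂ)).re ∧
        0 < ((((z * θ₁⁻¹ : Circle) : ℂ)) ^ 2).re} :=
      isOpen_setOf_re_pos_re_sq_pos.preimage (continuous_mul_const θ₁⁻¹)
    have h₂ : IsOpen {z : Circle | 0 < (((z * θ₂⁻¹ : Circle) : ℂ)).re} :=
      (isOpen_lt continuous_const (Complex.continuous_re.comp continuous_subtype_val)).preimage
        (continuous_mul_const θ₂⁻¹)
    exact ((h₁.preimage continuous_fst).inter (h₂.preimage continuous_snd)).preimage hout.continuous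
  have hFsm : ContMDiffOn (𝓡 2) 𝓘(ℝ, EuclideanSpace ℝ (Fin 2)) ∞ F S := by
    have hℓ₁ : ContMDiffOn (𝓡 2) 𝓘(ℝ, ℝ) ∞ (fun x => ℓ θ₁ (out x).1) S :=
      (contMDiffOn_coord θ₁).comp (contMDiff_fst.comp hout).contMDiffOn fun x hx => hx.1.2
    have hℓ₂ : ContMDiffOn (𝓡 2) 𝓘(ℝ, ℝ) ∞ (fun x => ℓh θ₂ (out x).2) S :=
      (contMDiffOn_halfCoord θ₂).comp (contMDiff_snd.comp hout).contMDiffOn fun x hx => hx.2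
    exact ((contMDiffOn_const.mul hℓ₁).smul contMDiffOn_const).add
      ((contMDiffOn_const.mul hℓ₂).smul contMDiffOn_const)
  have hproj : ∀ i : Fin 2, ContMDiff (𝓡 2) 𝓘(ℝ, ℝ) ∞ (fun v : EuclideanSpace ℝ (Fin 2) => v i) :=
    fun i => (EuclideanSpace.proj (𝕜 := ℝ) (ι := Fin 2) i).contMDiff
  have hGsm : ContMDiff 𝓘(ℝ, EuclideanSpace ℝ (Fin 2)) (𝓡 2) ∞ G := by
    obtain ⟨-, harc₁, -⟩ := injective_contMDiff_isOpenMap_mul_circleExp_arctan_half θ₁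
    have harc₂ : ContMDiff 𝓘(ℝ, ℝ) (𝓡 1) ∞ (arch θ₂) := contMDiff_mul_left.comp contMDiff_circleExp_arctan
    have h0 : ContMDiff 𝓘(ℝ, EuclideanSpace ℝ (Fin 2)) 𝓘(ℝ, ℝ) ∞
        (fun v : EuclideanSpace ℝ (Fin 2) => v 0 / c) := (hproj 0).div_const c
    have h1 : ContMDiff 𝓘(ℝ, EuclideanSpace ℝ (Fin 2)) 𝓘(ℝ, ℝ) ∞
        (fun v : EuclideanSpace ℝ (Fin 2) => v 1 / c) := (hproj 1).div_const c
    exact hinto.comp ((harc₁.comp h0).prodMk (harc₂.comp h1))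
  -- the chart
  let e : OpenPartialHomeomorph (Rechart f (Circle × Circle)) (EuclideanSpace ℝ (Fin 2)) :=
    { toFun := F
      invFun := G
      source := S
      target := univ
      map_source' := fun _ _ => mem_univ _
      map_target' := fun v _ => hGS v
      left_inv' := fun x hx => hGF x hx
      right_inv' := fun v _ => hFG v
      open_source := hSo
      open_target := isOpen_univ
      continuousOn_toFun := hFsm.continuousOn
      continuousOn_invFun := hGsm.continuous.continuousOn }
  have he : e ∈ IsManifold.maximalAtlas (𝓡 2) ∞ (Rechart f (Circle × Circle)) :=
    e.mem_maximalAtlas_of_contMDiffOn hFsm hGsm.contMDiffOn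
  refine ⟨e, he, rfl, rfl, fun x => ⟨hF0 x, hF1 x⟩, fun v => rfl, ?_⟩
  -- centred
  show F (into (θ₁, θ₂)) = 0
  have h : out (into (θ₁, θ₂)) = (θ₁, θ₂) := Rechart.out_into f _ _
  ext i
  fin_cases i
  · show F (into (θ₁, θ₂)) 0 = 0
    rw [hF0, h]
    simp [ℓ]
  · show F (into (θ₁, θ₂)) 1 = 0
    rw [hF1, h]
    show c * ((((θ₂ * θ₂⁻¹ : Circle) : ℂ)).im / (((θ₂ * θ₂⁻¹ : Circle) : ℂ)).re) = 0
    rw [mul_inv_cancel]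
    simp


end Literature.Topology.FourManifolds
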